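import Literature.MathematicalPhysics.QuantumLattice.HubbardScaleReport

/-!
# The tree-line estimate for one contracted covariance line
# (crux `SeededBrokenRegimeBoseFermiPinned` = stmt-HubbardSuperconductivity-14047, route AposterioriCapRg; supports, lead c4; stub `stub_pinnedSumContractedTensorLe`)

WHAT. The Gawȩdzki–Kupiainen / Salmhofer tree-line estimate at the level of plain coefficient
functions.  Two kernels `A` (legs `X, U`, with `a + 1` legs) and `B` (legs `Y, V`, with `b + 1`
legs) contracted through ONE covariance line `C X Y` give the `(a + b)`-leg function
`T W = Σ_{X,Y} C X Y · A (X, W₁) · B (Y, W₂)`, where `W = (W₁, W₂)` is split into its two blocks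
by `Fin.castAdd` / `Fin.natAdd`.  If `‖C X Y‖ ≤ wt X · wt Y · D X Y` with `D ≥ 0`, then every
leg-weighted pinned `L¹` sum of `T` (a fixed leg `p` carrying a fixed label `w`) is at most
`max cR cC · (cA · cB)`, where `cR`, `cC` bound the row and column sums of `D` (the `L¹–L^∞` norm
of the line measured against the leg weights) and `cA`, `cB` bound the weighted pinned sums of `A`
and `B`.  This is the combinatorial heart of the `L¹–L^∞` estimate for the quadratic term
`½ Σ Ċ ∂𝒢 ∂𝒢` of Polchinski's equation in the leg-weighted norm `legKernelNorm` of the route's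
scale report.

HOW. Pointwise, `‖Σ_{X,Y} C A B‖ ≤ Σ_{X,Y} wt X wt Y D ‖A‖ ‖B‖`, and the weights regroup as
`∏_q wt (W q) · wt X · wt Y = (∏_q wt (X ∷ W₁) q) · (∏_q wt (Y ∷ W₂) q)` (`Fin.prod_univ_add`,
`Fin.prod_univ_succ`).  The sum over `W` with `W p = w` is the double sum over `(W₁, W₂)`
(`Fin.appendEquiv`), pinned in exactly one block (`Fin.addCases` on `p`).  If the pinned leg is in
`A`'s block, sum first over the free block: `Σ_{W₂} β (Y ∷ W₂)` is `B`'s pinned sum at leg `0`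
with label `Y` (`≤ cB`), then `Σ_Y D X Y · cB ≤ cR · cB`, and what is left is `A`'s pinned sum at
leg `i.succ` with label `w` (`≤ cA`).  The other block is the mirror image with the column bound
`cC`.  Everything is finite bookkeeping with nonnegative terms.

SOURCES. M. Salmhofer, Commun. Math. Phys. 194 (1998) 249–295, §4.1, Lemma 1 (the tree-line
estimate) [`Salmhofer1998`]; K. Gawȩdzki, A. Kupiainen, Commun. Math. Phys. 102 (1985) 1–30.  The
finite-dimensional inequality proved here is folklore.

The file proves, in the sub-namespace `ContractedTensor`, generic reindexing lemmas (sums over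
`Fin (n + 1) → Γ` through `Fin.cons`, sums over `Fin (a + b) → Γ` through `Fin.append`), the
pointwise bound (any non-unital seminormed ring of scalars), the pinned sums in either block, and
the real-valued core estimate; then the registered stub (scalars `ℂ`, real weights).
-/

set_option linter.dupNamespace false -- `Summit.<S>.<S>` doubles the summit name (tree convention)

namespace Summit.HubbardSuperconductivity.HubbardSuperconductivity.Theorems.AposterioriCapRgSeededBrokenRegimeBoseFermiPinned

open Literature.MathematicalPhysics.QuantumLattice GrassmannAlgebra

namespace ContractedTensor

variable {M : Type*} [AddCommMonoid M] {Γ : Type*} [Fintype Γ]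

/-! ### Reindexing sums over tuples -/

/-- A sum over `(n + 1)`-tuples is the double sum over the head and the tail (`Fin.consEquiv`).
[folklore] -/
theorem sum_pi_succ {n : ℕ} (f : (Fin (n + 1) → Γ) → M) :
    ∑ U, f U = ∑ X : Γ, ∑ W : Fin n → Γ, f (Fin.cons X W) := by
  rw [← Fintype.sum_prod_type']
  exact (Fintype.sum_equiv (Fin.consEquiv fun _ => Γ) _ _ fun _ => rfl).symm

/-- A sum over `(a + b)`-tuples is the double sum over the two blocks (`Fin.appendEquiv`).
[folklore] -/
theorem sum_pi_add {a b : ℕ} (g : (Fin (a + b) → Γ) → M) :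
    ∑ W, g W = ∑ W₁ : Fin a → Γ, ∑ W₂ : Fin b → Γ, g (Fin.append W₁ W₂) := by
  rw [← Fintype.sum_prod_type']
  exact (Fintype.sum_equiv (Fin.appendEquiv a b) _ _ fun _ => rfl).symm

/-! ### The pointwise bound -/

/-- Pointwise bound of one weighted term of the contracted tensor: the triangle inequality for the
double sum, `‖C X Y‖ ≤ wt X · wt Y · D X Y`, and the regrouping of the leg weights
`∏_q wt (W q) · wt X · wt Y = (∏_q wt ((X ∷ W₁) q)) · (∏_q wt ((Y ∷ W₂) q))`. [folklore] -/
theorem weight_mul_norm_contracted_le {𝕜 : Type*} [NonUnitalSeminormedRing 𝕜] {a b : ℕ}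
    (wt : Γ → ℝ) (hwt : ∀ X, 0 ≤ wt X) (A : (Fin (a + 1) → Γ) → 𝕜) (B : (Fin (b + 1) → Γ) → 𝕜)
    (C : Matrix Γ Γ 𝕜) (D : Γ → Γ → ℝ) (hC : ∀ X Y, ‖C X Y‖ ≤ wt X * wt Y * D X Y)
    (W : Fin (a + b) → Γ) :
    (∏ q, wt (W q)) *
        ‖∑ X, ∑ Y, C X Y * (A (Fin.cons X fun i => W (Fin.castAdd b i)) *
          B (Fin.cons Y fun j => W (Fin.natAdd a j)))‖ ≤
      ∑ X, ∑ Y, D X Y *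
        (((∏ q, wt ((Fin.cons X (fun i => W (Fin.castAdd b i)) : Fin (a + 1) → Γ) q)) *
            ‖A (Fin.cons X fun i => W (Fin.castAdd b i))‖) *
          ((∏ q, wt ((Fin.cons Y (fun j => W (Fin.natAdd a j)) : Fin (b + 1) → Γ) q)) *
            ‖B (Fin.cons Y fun j => W (Fin.natAdd a j))‖)) := by
  have hw : 0 ≤ ∏ q, wt (W q) := Finset.prod_nonneg fun q _ => hwt _
  calc (∏ q, wt (W q)) *
        ‖∑ X, ∑ Y, C X Y * (A (Fin.cons X fun i => W (Fin.castAdd b i)) *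
          B (Fin.cons Y fun j => W (Fin.natAdd a j)))‖
      ≤ (∏ q, wt (W q)) * ∑ X, ∑ Y, wt X * wt Y * D X Y *
          (‖A (Fin.cons X fun i => W (Fin.castAdd b i))‖ *
            ‖B (Fin.cons Y fun j => W (Fin.natAdd a j))‖) := by
        refine mul_le_mul_of_nonneg_left ((norm_sum_le _ _).trans (Finset.sum_le_sum fun X _ =>
          (norm_sum_le _ _).trans (Finset.sum_le_sum fun Y _ => ?_))) hw
        exact (norm_mul_le _ _).trans
          (mul_le_mul (hC X Y) (norm_mul_le _ _) (norm_nonneg _) ((norm_nonneg _).trans (hC X Y)))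
    _ = _ := by
        rw [Finset.mul_sum]
        refine Finset.sum_congr rfl fun X _ => ?_
        rw [Finset.mul_sum]
        refine Finset.sum_congr rfl fun Y _ => ?_
        rw [Fin.prod_univ_add, Fin.prod_univ_succ, Fin.prod_univ_succ]
        simp only [Fin.cons_zero, Fin.cons_succ]
        ring

/-! ### Pinned sums -/

variable [DecidableEq Γ]

/-- Summing `f (Y ∷ W)` over the tail `W` is the pinned sum of `f` at leg `0` with label `Y`.
[folklore] -/
theorem sum_cons_eq_pinnedSum_zero {n : ℕ} (f : (Fin (n + 1) → Γ) → M) (Y : Γ) :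
    ∑ W : Fin n → Γ, f (Fin.cons Y W) =
      ∑ V ∈ Finset.univ.filter (fun V : Fin (n + 1) → Γ => V 0 = Y), f V := by
  rw [Finset.sum_filter, sum_pi_succ, Finset.sum_comm]
  simp only [Fin.cons_zero, Finset.sum_ite_eq', Finset.mem_univ, if_true]

/-- Summing `f (X ∷ W)` over all heads `X` and the tails `W` pinned at leg `i` is the pinned sum of
`f` at leg `i.succ`. [folklore] -/
theorem sum_sum_cons_pinned_eq {n : ℕ} (f : (Fin (n + 1) → Γ) → M) (i : Fin n) (w : Γ) :
    ∑ X : Γ, ∑ W ∈ Finset.univ.filter (fun W : Fin n → Γ => W i = w), f (Fin.cons X W) =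
      ∑ U ∈ Finset.univ.filter (fun U : Fin (n + 1) → Γ => U i.succ = w), f U := by
  rw [Finset.sum_filter, sum_pi_succ]
  simp only [Fin.cons_succ, Finset.sum_filter]

/-- A sum over `(a + b)`-tuples pinned in the FIRST block, of a function of the two blocks, is the
double sum over the pinned first block and the free second block. [folklore] -/
theorem pinnedSum_castAdd_eq {a b : ℕ} (G : (Fin a → Γ) → (Fin b → Γ) → M) (i : Fin a) (w : Γ) :
    ∑ W ∈ Finset.univ.filter (fun W : Fin (a + b) → Γ => W (Fin.castAdd b i) = w),
        G (fun k => W (Fin.castAdd b k)) (fun k => W (Fin.natAdd a k)) =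
      ∑ W₁ ∈ Finset.univ.filter (fun W₁ : Fin a → Γ => W₁ i = w), ∑ W₂ : Fin b → Γ, G W₁ W₂ := by
  rw [Finset.sum_filter, sum_pi_add, Finset.sum_filter]
  simp only [Fin.append_left, Fin.append_right]
  refine Finset.sum_congr rfl fun W₁ _ => ?_
  by_cases h : W₁ i = w <;> simp [h]

/-- A sum over `(a + b)`-tuples pinned in the SECOND block, of a function of the two blocks, is the
double sum over the pinned second block and the free first block. [folklore] -/
theorem pinnedSum_natAdd_eq {a b : ℕ} (G : (Fin a → Γ) → (Fin b → Γ) → M) (j : Fin b) (w : Γ) :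
    ∑ W ∈ Finset.univ.filter (fun W : Fin (a + b) → Γ => W (Fin.natAdd a j) = w),
        G (fun k => W (Fin.castAdd b k)) (fun k => W (Fin.natAdd a k)) =
      ∑ W₂ ∈ Finset.univ.filter (fun W₂ : Fin b → Γ => W₂ j = w), ∑ W₁ : Fin a → Γ, G W₁ W₂ := by
  rw [Finset.sum_filter, sum_pi_add, Finset.sum_filter, Finset.sum_comm]
  simp only [Fin.append_left, Fin.append_right]
  refine Finset.sum_congr rfl fun W₂ _ => ?_
  by_cases h : W₂ j = w <;> simp [h]

/-! ### The real-valued core estimate -/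

/-- The tree-line estimate for the double sum pinned in the first block: contract the line into the
free block (`B`'s pinned sum at the new leg, then a row sum of `D`), and what is left is `A`'s
pinned sum at the shifted leg.  All terms are nonnegative. [cite: Salmhofer1998, §4.1] -/
theorem core_left {a b : ℕ} (α : (Fin (a + 1) → Γ) → ℝ) (β : (Fin (b + 1) → Γ) → ℝ)
    (D : Γ → Γ → ℝ) (hα : ∀ U, 0 ≤ α U) (hβ : ∀ V, 0 ≤ β V) (hD : ∀ X Y, 0 ≤ D X Y)
    {cA cB cR : ℝ} (i : Fin a) (w : Γ)
    (hA : ∑ U ∈ Finset.univ.filter (fun U : Fin (a + 1) → Γ => U i.succ = w), α U ≤ cA)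
    (hB : ∀ Y, ∑ V ∈ Finset.univ.filter (fun V : Fin (b + 1) → Γ => V 0 = Y), β V ≤ cB)
    (hR : ∀ X, ∑ Y, D X Y ≤ cR) :
    ∑ W₁ ∈ Finset.univ.filter (fun W₁ : Fin a → Γ => W₁ i = w), ∑ W₂ : Fin b → Γ,
        ∑ X, ∑ Y, D X Y * (α (Fin.cons X W₁) * β (Fin.cons Y W₂)) ≤ cR * (cA * cB) := by
  have hcB : 0 ≤ cB := (Finset.sum_nonneg fun V _ => hβ V).trans (hB w)
  have hcR : 0 ≤ cR := (Finset.sum_nonneg fun Y _ => hD w Y).trans (hR w)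
  -- the free block: `B`'s pinned sum at leg `0`, then a row sum of `D`
  have hin : ∀ X, ∑ Y, D X Y * ∑ W₂ : Fin b → Γ, β (Fin.cons Y W₂) ≤ cR * cB := fun X =>
    calc ∑ Y, D X Y * ∑ W₂ : Fin b → Γ, β (Fin.cons Y W₂)
        ≤ ∑ Y, D X Y * cB := Finset.sum_le_sum fun Y _ =>
          mul_le_mul_of_nonneg_left ((sum_cons_eq_pinnedSum_zero β Y).trans_le (hB Y)) (hD X Y)
      _ ≤ cR * cB := by
          rw [← Finset.sum_mul]
          exact mul_le_mul_of_nonneg_right (hR X) hcB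
  calc ∑ W₁ ∈ Finset.univ.filter (fun W₁ : Fin a → Γ => W₁ i = w), ∑ W₂ : Fin b → Γ,
          ∑ X, ∑ Y, D X Y * (α (Fin.cons X W₁) * β (Fin.cons Y W₂))
      = ∑ W₁ ∈ Finset.univ.filter (fun W₁ : Fin a → Γ => W₁ i = w),
          ∑ X, α (Fin.cons X W₁) * ∑ Y, D X Y * ∑ W₂ : Fin b → Γ, β (Fin.cons Y W₂) := by
        refine Finset.sum_congr rfl fun W₁ _ => ?_
        rw [Finset.sum_comm]
        refine Finset.sum_congr rfl fun X _ => ?_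
        rw [Finset.sum_comm, Finset.mul_sum]
        refine Finset.sum_congr rfl fun Y _ => ?_
        rw [Finset.mul_sum, Finset.mul_sum]
        exact Finset.sum_congr rfl fun W₂ _ => by ring
    _ ≤ ∑ W₁ ∈ Finset.univ.filter (fun W₁ : Fin a → Γ => W₁ i = w),
          ∑ X, α (Fin.cons X W₁) * (cR * cB) :=
        Finset.sum_le_sum fun W₁ _ => Finset.sum_le_sum fun X _ =>
          mul_le_mul_of_nonneg_left (hin X) (hα _)
    _ = (∑ X, ∑ W₁ ∈ Finset.univ.filter (fun W₁ : Fin a → Γ => W₁ i = w), α (Fin.cons X W₁)) *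
          (cR * cB) := by
        rw [Finset.sum_mul, Finset.sum_comm]
        exact Finset.sum_congr rfl fun X _ => (Finset.sum_mul _ _ _).symm
    _ ≤ cA * (cR * cB) :=
        mul_le_mul_of_nonneg_right ((sum_sum_cons_pinned_eq α i w).trans_le hA)
          (mul_nonneg hcR hcB)
    _ = cR * (cA * cB) := by ring

/-- The tree-line estimate for the pinned sums of the contracted tensor, real-valued form: for
nonnegative `α`, `β`, `D` with pinned sums of `α`, `β` bounded by `cA`, `cB` and row / column sums
of `D` bounded by `cR` / `cC`, every pinned sum of
`W ↦ Σ_{X,Y} D X Y · α (X ∷ W₁) · β (Y ∷ W₂)` is at most `max cR cC · (cA · cB)`.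
[cite: Salmhofer1998, §4.1] -/
theorem pinnedSum_contracted_le {a b : ℕ} (α : (Fin (a + 1) → Γ) → ℝ) (β : (Fin (b + 1) → Γ) → ℝ)
    (D : Γ → Γ → ℝ) (hα : ∀ U, 0 ≤ α U) (hβ : ∀ V, 0 ≤ β V) (hD : ∀ X Y, 0 ≤ D X Y)
    {cA cB cR cC : ℝ}
    (hA : ∀ (p : Fin (a + 1)) (x : Γ),
      ∑ U ∈ Finset.univ.filter (fun U : Fin (a + 1) → Γ => U p = x), α U ≤ cA)
    (hB : ∀ (p : Fin (b + 1)) (x : Γ),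
      ∑ V ∈ Finset.univ.filter (fun V : Fin (b + 1) → Γ => V p = x), β V ≤ cB)
    (hR : ∀ X, ∑ Y, D X Y ≤ cR) (hC : ∀ Y, ∑ X, D X Y ≤ cC) (p : Fin (a + b)) (w : Γ) :
    ∑ W ∈ Finset.univ.filter (fun W : Fin (a + b) → Γ => W p = w),
        ∑ X, ∑ Y, D X Y * (α (Fin.cons X fun i => W (Fin.castAdd b i)) *
          β (Fin.cons Y fun j => W (Fin.natAdd a j))) ≤ max cR cC * (cA * cB) := by
  have hcA : 0 ≤ cA := (Finset.sum_nonneg fun U _ => hα U).trans (hA 0 w)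
  have hcB : 0 ≤ cB := (Finset.sum_nonneg fun V _ => hβ V).trans (hB 0 w)
  have hAB : 0 ≤ cA * cB := mul_nonneg hcA hcB
  induction p using Fin.addCases with
  | left i =>
    refine (pinnedSum_castAdd_eq
      (fun W₁ W₂ => ∑ X, ∑ Y, D X Y * (α (Fin.cons X W₁) * β (Fin.cons Y W₂))) i w).trans_le ?_
    exact (core_left α β D hα hβ hD i w (hA i.succ w) (hB 0) hR).trans
      (mul_le_mul_of_nonneg_right (le_max_left _ _) hAB)
  | right j =>
    refine (pinnedSum_natAdd_eq
      (fun W₁ W₂ => ∑ X, ∑ Y, D X Y * (α (Fin.cons X W₁) * β (Fin.cons Y W₂))) j w).trans_le ?_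
    calc ∑ W₂ ∈ Finset.univ.filter (fun W₂ : Fin b → Γ => W₂ j = w), ∑ W₁ : Fin a → Γ,
            ∑ X, ∑ Y, D X Y * (α (Fin.cons X W₁) * β (Fin.cons Y W₂))
        = ∑ W₂ ∈ Finset.univ.filter (fun W₂ : Fin b → Γ => W₂ j = w), ∑ W₁ : Fin a → Γ,
            ∑ Y, ∑ X, D X Y * (β (Fin.cons Y W₂) * α (Fin.cons X W₁)) :=
          Finset.sum_congr rfl fun W₂ _ => Finset.sum_congr rfl fun W₁ _ => by
            rw [Finset.sum_comm]
            exact Finset.sum_congr rfl fun Y _ => Finset.sum_congr rfl fun X _ => by ring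
      _ ≤ cC * (cB * cA) :=
          core_left β α (fun Y X => D X Y) hβ hα (fun Y X => hD X Y) j w (hB j.succ w) (hA 0) hC
      _ ≤ max cR cC * (cA * cB) := by
          rw [mul_comm cB cA]
          exact mul_le_mul_of_nonneg_right (le_max_right _ _) hAB

end ContractedTensor

/-! ### The registered stub -/

/-- **Tree-line estimate (`ContractedTensor`)**: two coefficient functions `A` (`a + 1` legs) and
`B` (`b + 1` legs) contracted through one covariance line `C X Y` with
`‖C X Y‖ ≤ wt X · wt Y · D X Y` give an `(a + b)`-leg function all of whose leg-weighted pinned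
`L¹` sums are at most `max cR cC · (cA · cB)`: the `L¹–L^∞` norm of the line (row / column sums of
`D`) times the pinned norms of `A` and `B`. [cite: Salmhofer1998, §4.1] -/
theorem stub_pinnedSumContractedTensorLe :
    ∀ {Γ : Type} [Fintype Γ] [DecidableEq Γ] (wt : Γ → ℝ), (∀ X, 0 ≤ wt X) →
      ∀ (a b : ℕ) (A : (Fin (a + 1) → Γ) → ℂ) (B : (Fin (b + 1) → Γ) → ℂ) (C : Matrix Γ Γ ℂ) (D : Γ → Γ → ℝ),
        (∀ X Y, 0 ≤ D X Y) → (∀ X Y, ‖C X Y‖ ≤ wt X * wt Y * D X Y) →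
        ∀ (cA cB cR cC : ℝ),
          (∀ (p : Fin (a + 1)) (x : Γ),
            ∑ U ∈ Finset.univ.filter (fun U : Fin (a + 1) → Γ => U p = x), (∏ q, wt (U q)) * ‖A U‖ ≤ cA) →
          (∀ (p : Fin (b + 1)) (x : Γ),
            ∑ V ∈ Finset.univ.filter (fun V : Fin (b + 1) → Γ => V p = x), (∏ q, wt (V q)) * ‖B V‖ ≤ cB) →
          (∀ X, ∑ Y, D X Y ≤ cR) → (∀ Y, ∑ X, D X Y ≤ cC) →
          ∀ (p : Fin (a + b)) (w : Γ),
            ∑ W ∈ Finset.univ.filter (fun W : Fin (a + b) → Γ => W p = w),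
                (∏ q, wt (W q)) *
                  ‖∑ X, ∑ Y, C X Y * (A (Fin.cons X fun i => W (Fin.castAdd b i)) *
                    B (Fin.cons Y fun j => W (Fin.natAdd a j)))‖ ≤ max cR cC * (cA * cB) := by
  intro Γ _ _ wt hwt a b A B C D hD hC cA cB cR cC hA hB hR hCol p w
  refine (Finset.sum_le_sum fun W _ =>
    ContractedTensor.weight_mul_norm_contracted_le wt hwt A B C D hC W).trans ?_
  exact ContractedTensor.pinnedSum_contracted_le (fun U => (∏ q, wt (U q)) * ‖A U‖)
    (fun V => (∏ q, wt (V q)) * ‖B V‖) D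
    (fun U => mul_nonneg (Finset.prod_nonneg fun q _ => hwt _) (norm_nonneg _))
    (fun V => mul_nonneg (Finset.prod_nonneg fun q _ => hwt _) (norm_nonneg _)) hD hA hB hR hCol p w

end Summit.HubbardSuperconductivity.HubbardSuperconductivity.Theorems.AposterioriCapRgSeededBrokenRegimeBoseFermiPinned
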